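import Summits.RiemannHypothesis.RiemannHypothesis.Theorems.GroundBartaEvenWinsBeyondArchPhantomXT120Cells
import Summits.RiemannHypothesis.RiemannHypothesis.Theorems.GroundBartaEvenWinsBeyondArchPhantomXT120Check0
import Summits.RiemannHypothesis.RiemannHypothesis.Theorems.GroundBartaEvenWinsBeyondArchPhantomXT120Check1
import Summits.RiemannHypothesis.RiemannHypothesis.Theorems.GroundBartaEvenWinsBeyondArchPhantomXT120Check2
import Summits.RiemannHypothesis.RiemannHypothesis.Theorems.GroundBartaEvenWinsBeyondArchPhantomXT120Check3
import Summits.RiemannHypothesis.RiemannHypothesis.Theorems.GroundBartaEvenWinsBeyondArchPhantomXT120Check4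
import Summits.RiemannHypothesis.RiemannHypothesis.Theorems.GroundBartaEvenWinsBeyondArchPhantomXT120Check5
import Summits.RiemannHypothesis.RiemannHypothesis.Theorems.GroundBartaEvenWinsBeyondArchPhantomXT120Check6
import Summits.RiemannHypothesis.RiemannHypothesis.Theorems.GroundBartaEvenWinsBeyondArchPhantomXT120Check7
import Summits.RiemannHypothesis.RiemannHypothesis.Theorems.GroundBartaEvenWinsBeyondArchPhantomXT120Check8
import Summits.RiemannHypothesis.RiemannHypothesis.Theorems.GroundBartaEvenWinsBeyondArchPhantomXT120Check9
import Summits.RiemannHypothesis.RiemannHypothesis.Theorems.GroundBartaEvenWinsBeyondArchPhantomXT120Check10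
import Summits.RiemannHypothesis.RiemannHypothesis.Theorems.GroundBartaEvenWinsBeyondArchPhantomXT120Check11
import Summits.RiemannHypothesis.RiemannHypothesis.Theorems.GroundBartaEvenWinsBeyondArchPhantomXT120Check12
import Summits.RiemannHypothesis.RiemannHypothesis.Theorems.GroundBartaEvenWinsBeyondArchPhantomXT120Check13
import Summits.RiemannHypothesis.RiemannHypothesis.Theorems.GroundBartaEvenWinsBeyondArchPhantomXT120Check14
import Summits.RiemannHypothesis.RiemannHypothesis.Theorems.GroundBartaEvenWinsBeyondArchPhantomXT120Check15
import Summits.RiemannHypothesis.RiemannHypothesis.Theorems.GroundBartaEvenWinsBeyondArchPhantomXT120Check16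
import Summits.RiemannHypothesis.RiemannHypothesis.Theorems.GroundBartaEvenWinsBeyondArchPhantomXT120Check17
import Summits.RiemannHypothesis.RiemannHypothesis.Theorems.GroundBartaEvenWinsBeyondArchPhantomXT120Check18
import Summits.RiemannHypothesis.RiemannHypothesis.Theorems.GroundBartaEvenWinsBeyondArchPhantomXT120Check19
import Summits.RiemannHypothesis.RiemannHypothesis.Theorems.GroundBartaEvenWinsBeyondArchPhantomXT120Check20
import Summits.RiemannHypothesis.RiemannHypothesis.Theorems.GroundBartaEvenWinsBeyondArchPhantomXT120Check21
import Summits.RiemannHypothesis.RiemannHypothesis.Theorems.GroundBartaEvenWinsBeyondArchPhantomXT120Check22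
import Summits.RiemannHypothesis.RiemannHypothesis.Theorems.GroundBartaEvenWinsBeyondArchPhantomXT120Check23
import HarnessLib

/-!
# RiemannHypothesis / GroundBarta machinery — phantom chain XT120: validity `XCellsOK`

Helper DATA file (`--supports stmt-RiemannHypothesis-18085 --as helper`), RH-free.  Seat rh-explicit-weil-1.  Part of the T = 120 lattice-ripple (phantom) chain `xt120Cells` for the separable 12-harmonic phantom `rsOfSep xt120Ph2 xt120Ph3` (θ₂-harmonics j = 3..8, θ₃-harmonics k = 2..7; LP/Fejér–Riesz data of kit j143029): Taylor-sum cells `XTCell` of width 1/2, order n = 24, two-sided engine claims with margin 2e-8, generated by `gen/phantomgen.py` (exact mirror of the checker; nothing about the data is trusted — only kernel-evaluated Booleans are consumed).  With the boosted tail level wL = 269/100 (`xt120Level`: ∀ |t| ≥ 120, 269/100 ≤ w₂₃(t) + P(t)) this chain turns the LANDED two-prime T120 chain (level ≈ 1.8455 pointwise-amplitude, 2.09 sharp) into a level-269/100 chain for the phantom certificate format `WeilCert23X` (…PhantomCertificate*.lean; memo rh-explicit-weil-1/FORMAT-PHANTOM.md).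
-/

set_option linter.dupNamespace false

noncomputable section

namespace Summit.RiemannHypothesis.RiemannHypothesis.Theorems.EvenWinsBeyondArch

open Literature.NumberTheory.LFunctions

/-- All cells pass the checker (assembled from the per-chunk kernel facts). [folklore] -/
theorem checkZAll_xt120 : (xt120Cells.all XTCell.checkZ) = true := by
  simp only [xt120Cells, List.all_append, checkZ_xt120Cells0, checkZ_xt120Cells1, checkZ_xt120Cells2, checkZ_xt120Cells3, checkZ_xt120Cells4, checkZ_xt120Cells5, checkZ_xt120Cells6, checkZ_xt120Cells7, checkZ_xt120Cells8, checkZ_xt120Cells9, checkZ_xt120Cells10, checkZ_xt120Cells11, checkZ_xt120Cells12, checkZ_xt120Cells13, checkZ_xt120Cells14, checkZ_xt120Cells15, checkZ_xt120Cells16, checkZ_xt120Cells17, checkZ_xt120Cells18, checkZ_xt120Cells19, checkZ_xt120Cells20, checkZ_xt120Cells21, checkZ_xt120Cells22, checkZ_xt120Cells23, Bool.and_self]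

/-- The integer chain checker passes. [folklore] -/
theorem checkXCells_xt120 : checkXCells xt120Rs 120 xt120Cells = true := by
  unfold checkXCells
  rw [checkChain_xt120, checkZAll_xt120, ripples_xt120]
  rfl

/-- **The XT120 phantom chain is a valid lattice-ripple chain** for `xt120Rs` on [0, 120]. [folklore] -/
theorem xCellsOK_xt120 : XCellsOK xt120Rs 120 xt120Cells :=
  xCellsOK_of_checkXCells checkXCells_xt120

end Summit.RiemannHypothesis.RiemannHypothesis.Theorems.EvenWinsBeyondArch

end
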